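import Summits.PneNP.PneNP.Theses.Circuit2
import Literature.Computability.MetaComplexity.CircuitMagnificationProofs

/-!
# Route PneNP/Circuit — support item `CircuitMagnificationGlue` (stmt-PneNP-13940)

The fact-free glue `#5R → X` of route `PneNP/Circuit`: hardness magnification for `MCSP[s]` in its
circuit form (McKay–Murray–Williams, STOC 2019, Thm. 1.4, third bullet; proof §5 via Lemma 3.1),
specialised to the route's crux `CircuitMagnificationFrontierR`: if some time-constructible `s` with
`log s(n) = o(n)` has `MCSP[s] ∉ SIZE(N ↦ N · s(⌊log₂ N⌋)^c + c)` for every `c`, then `NP ⊄ P/poly`.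

Proof: dock onto the DISCHARGED Literature fact
`Literature.Computability.MetaComplexity.MckayMurrayWilliams2019_thm14_holds`
(`CircuitMagnificationProofs.lean`), whose hypothesis `∀ n, n ≤ s n` is the first conjunct of
`Literature.Computability.Complexity.IsTimeConstructible s`; the `log s = o(n)` conjunct is not needed.
-/

set_option linter.dupNamespace false -- `Summit.PneNP.PneNP.…`: summit = sub-problem name (D-0017 single-conjunct layout)

namespace Summit.PneNP.PneNP.Theorems

/-- **Support item `CircuitMagnificationGlue` (stmt-PneNP-13940) of route `PneNP/Circuit`, proved.**
If some time-constructible size function `s` with `log s(n) = o(n)` satisfies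
`MCSP[s] ∉ SIZE(N ↦ N · s(⌊log₂ N⌋)^c + c)` for every `c`, then `¬ (NP ⊆ P/poly)`.
Immediate from McKay–Murray–Williams 2019, Thm. 1.4 (third bullet), discharged in the tree as
`Literature.Computability.MetaComplexity.MckayMurrayWilliams2019_thm14_holds`, using
`IsTimeConstructible s → ∀ n, n ≤ s n`. [cite: MckayMurrayWilliams2019, Thm. 1.4 (third bullet), §5] -/
theorem circuitMagnificationGlue_proof :
    Summit.PneNP.PneNP.Theses.Circuit2.CircuitMagnificationGlue := by
  unfold Summit.PneNP.PneNP.Theses.Circuit2.CircuitMagnificationGlue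
  rintro ⟨s, hs, -, hlb⟩
  exact Literature.Computability.MetaComplexity.MckayMurrayWilliams2019_thm14_holds s hs.1 hlb

end Summit.PneNP.PneNP.Theorems
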